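import Literature.IUT.LogThetaLattice.GlobalPacketsLGP
import Literature.RingTheory.Etale.PiTensorProductField
import Mathlib.NumberTheory.NumberField.Basic
import HarnessLib

/-!
# [IUTchIII] Propositions 3.3, 3.4 — proofs (companion of `GlobalPacketsLGP.lean`)

Proof-only companion (abc-iut cell, DISCHARGE-L6 §E2 LIST A, item A2) of
`Literature/IUT/LogThetaLattice/GlobalPacketsLGP.lean` (S. Mochizuki, *Inter-universal Teichmüller
theory III*, kurims manuscript (May 2020), §3, Proposition 3.3 pp. 99–100, Proposition 3.4
pp. 101–103; claim key Mochizuki2012, DISPUTED, D-0012 — the content proved here is classical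
algebra). No new definitions.

* **IUTchIII:Prop3.3(i)** "(Ring Structures)", p. 100 — `Prop33i_directSumOfNumberFields` (and its
  re-statement with the number-field binder, `Prop33i_directSumOfNumberFields'`)
  DISCHARGED: for labelled number fields `(†𝕄⊛_mod)_α`, the global tensor packet
  `(†𝕄⊛_mod)_A = ⊗_{α∈A} (†𝕄⊛_mod)_α` (tensor product over `ℚ`) "decomposes … as a direct sum of
  number fields" (`Prop33i_directSumOfNumberFields_of_numberField`; classical input: a finite tensor product
  of finite separable field extensions is a finite product of such,
  `Literature/RingTheory/Etale/PiTensorProductField.lean`, Knus–Merkurjev–Rost–Tignol §18.A). The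
  "uniquely" and the injective localization homomorphism of (i) are the interface datum
  `LocalizationHom` (NEEDS [IUTchII] Cor. 4.8 (iii), [IUTchIII] Def. 1.1 — not dischargeable here).
* **IUTchIII:Prop3.3(ii)**, p. 100 — `Prop33ii_ontoSubfield` DISCHARGED unconditionally
  (`Prop33ii_ontoSubfield_of_field`: the composite `(†𝕄⊛_mod)_α → (†𝕄⊛_mod)_A ≅ Π_i K_i → K_i` is a ring
  homomorphism out of a field into a field, hence injective, i.e. "an isomorphism of the domain
  onto a subfield of each of the direct summand number fields"). The integrality clauses
  `Prop33ii_integersNon` / `Prop33ii_integersArc` quantify over the interface `LocalizationHom` and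
  abstract integral structures: SLOTS (nothing to prove until the localization homomorphism is
  constructed).
* **IUTchIII:Prop3.4(i)**, pp. 101–102 — the single packet monoids are REAL images in the typed
  file; here: images of units are units (`singlePacketUnits_isUnit`), and the action clause
  `Prop34i_actsOn` DISCHARGED for the image of any `Ψ`-stable submodule
  (`Prop34i_actsOn_map`: "these monoids … act multiplicatively on suitable subquotients").
* **IUTchIII:Prop3.4(ii)**, pp. 102–103 — `LGPMonoidSignature` is an OUTPUT SIGNATURE whose
  Prop-valued fields quote print: SLOT (the construction NEEDS [IUTchI] Def. 6.13, [IUTchII]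
  Cor. 4.6 (iv), [IUTchIII] Def. 1.1); nothing is asserted or provable here beyond the in-file
  consequence `LGPMonoidSignature.smul_mem_IQ`.
-/

namespace Literature.IUT.LogThetaLattice

open scoped TensorProduct
open PiTensorProduct

universe u v w

/-! ### Proposition 3.3 -/

section GlobalPackets

variable {A : Type v} [Fintype A] [DecidableEq A]
variable (F : A → Type u) [∀ α, Field (F α)] [∀ α, Algebra ℚ (F α)]

omit [DecidableEq A] in
/-- **IUTchIII:Prop3.3(i)** (p. 100) DISCHARGED: if the `(†𝕄⊛_mod)_α` are number fields, the global
tensor packet `(†𝕄⊛_mod)_A = ⊗_{α∈A} (†𝕄⊛_mod)_α` is ring-isomorphic to a finite product of number fields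
(`Prop33i_directSumOfNumberFields F`): a finite tensor product over `ℚ` of finite (automatically
separable) extensions of `ℚ` is a finite product of finite extensions of `ℚ`
(`Literature.RingTheory.Etale.piTensorProduct_fields_exists_algEquiv_pi_field_of_charZero`), and a
field of finite degree over `ℚ` is a number field. The given `ℚ`-algebra structures on the `F α`
agree with the canonical ones (`Subsingleton (Module ℚ _)`). [claim: Mochizuki2012, status: disputed] -/
theorem Prop33i_directSumOfNumberFields_of_numberField [∀ α, NumberField (F α)] :
    Prop33i_directSumOfNumberFields F := by
  have hfin : ∀ α, Module.Finite ℚ (F α) := fun α => by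
    convert NumberField.to_finiteDimensional (K := F α) using 2
    exact Subsingleton.elim _ _
  obtain ⟨ι, hι, K, hK, hA, hfs, ⟨e⟩⟩ :=
    Literature.RingTheory.Etale.piTensorProduct_fields_exists_algEquiv_pi_field_of_charZero ℚ F
  have hcz : ∀ i, CharZero (K i) := fun i =>
    charZero_of_injective_algebraMap (algebraMap ℚ (K i)).injective
  obtain rfl : hA = fun i => @DivisionRing.toRatAlgebra (K i) _ (hcz i) := Subsingleton.elim _ _
  exact ⟨ι, hι, K, hK, fun i => @NumberField.mk (K i) (hK i) (hcz i) (hfs i).1, ⟨e.toRingEquiv⟩⟩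

omit [DecidableEq A] in
/-- **IUTchIII:Prop3.3(i)** (p. 100), the statement WITH the number-field binder appended to the typed
file (`Prop33i_directSumOfNumberFields'`, RQ7 finding L6-F2): DISCHARGED — identical content.
[claim: Mochizuki2012, status: disputed] -/
theorem Prop33i_directSumOfNumberFields'_of_numberField [∀ α, NumberField (F α)] :
    Prop33i_directSumOfNumberFields' F :=
  Prop33i_directSumOfNumberFields_of_numberField F

omit [Fintype A] in
/-- **IUTchIII:Prop3.3(ii)** (p. 100) DISCHARGED: for every decomposition `(†𝕄⊛_mod)_A ≅ Π_i K_i` into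
fields, the composite `(†𝕄⊛_mod)_α → (†𝕄⊛_mod)_A → K_i` is injective — "an isomorphism of the domain onto
a subfield of each of the direct summand number fields of the codomain"
(`Prop33ii_ontoSubfield F α`); it is a ring homomorphism from a field to a field.
[claim: Mochizuki2012, status: disputed] -/
theorem Prop33ii_ontoSubfield_of_field (α : A) : Prop33ii_ontoSubfield F α := by
  intro ι K _ e i
  exact ((Pi.evalRingHom K i).comp (e.toRingHom.comp (GlobalPacket.single F α).toRingHom)).injective

omit [Fintype A] in
/-- **IUTchIII:Prop3.3(ii)** (p. 100), first display: the natural ring homomorphism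
`(†𝕄⊛_mod)_α → (†𝕄⊛_mod)_A` ("tensor product with 1's") is itself injective (the codomain is a nonzero
ring: it maps onto the field `K_i` of any decomposition, and `Prop33i` provides one whenever the
`F α` are number fields; here stated for any nontrivial global packet).
[claim: Mochizuki2012, status: disputed] -/
theorem GlobalPacket.single_injective [Nontrivial (GlobalPacket F)] (α : A) :
    Function.Injective (GlobalPacket.single F α) :=
  (GlobalPacket.single F α).toRingHom.injective

end GlobalPackets

/-! ### Proposition 3.4 (i) -/

section SinglePacketMonoids

variable {𝕜 : Type u} [Field 𝕜] {Lv : Type v} [CommRing Lv] [Algebra 𝕜 Lv]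
variable {Pv : Type w} [CommRing Pv] [Algebra 𝕜 Pv]

/-- **IUTchIII:Prop3.4(i)** (p. 102): every element of `Ψ^×_{log(^{A,α}𝓕_v)}` — the image of the
"submonoid of units" `Ψ^×_{log(^α𝓕_v)}` — is a unit of the ring `log(^{A,α}𝓕_v)` (images of units
under a ring homomorphism are units). [claim: Mochizuki2012, status: disputed] -/
theorem singlePacketUnits_isUnit (ι : Lv →ₐ[𝕜] Pv) (Ψ : Submonoid Lv) {x : Pv}
    (hx : x ∈ singlePacketUnits ι Ψ) : IsUnit x := by
  obtain ⟨u, hu, rfl⟩ := hx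
  obtain ⟨w, hw⟩ := hu
  have h : IsUnit ((Ψ.subtype : Ψ →* Lv) u) := hw ▸ (w.map Ψ.subtype).isUnit
  exact h.map (ι : Lv →* Pv)

/-- **IUTchIII:Prop3.4(i)** (p. 102), action clause DISCHARGED: "We shall think of these monoids as
… subquotients of `log(^{A,α}𝓕_v)` that act [multiplicatively] on suitable … subquotients of
`log(^{A,α}𝓕_v)`" — if a sub-`𝕜`-module `N ⊆ log(^α𝓕_v)` is stable under multiplication by `Ψ`, then
its image in `log(^{A,α}𝓕_v)` is stable under the single packet monoid `Ψ_{log(^{A,α}𝓕_v)}`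
(`Prop34i_actsOn ι Ψ (N.map ι)`). [claim: Mochizuki2012, status: disputed] -/
theorem Prop34i_actsOn_map (ι : Lv →ₐ[𝕜] Pv) (Ψ : Submonoid Lv) (N : Submodule 𝕜 Lv)
    (hN : ∀ x ∈ Ψ, ∀ n ∈ N, x * n ∈ N) :
    Prop34i_actsOn ι Ψ (N.map ι.toLinearMap) := by
  rintro _ ⟨x, hx, rfl⟩ _ ⟨n, hn, rfl⟩
  exact ⟨x * n, hN x hx n hn, by simp⟩

/-- **IUTchIII:Prop3.4(i)** (p. 102), action clause, degenerate instance recorded for the audit: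
the whole ring `log(^{A,α}𝓕_v)` is (trivially) stable (`Prop34i_actsOn ι Ψ ⊤`), so the typed predicate
is a property of the chosen sub-module, not of the monoid. [claim: Mochizuki2012, status: disputed] -/
theorem Prop34i_actsOn_top (ι : Lv →ₐ[𝕜] Pv) (Ψ : Submonoid Lv) : Prop34i_actsOn ι Ψ ⊤ :=
  fun _ _ _ _ => Submodule.mem_top

end SinglePacketMonoids

/-! ### Proposition 3.3 (i): the header-binder statement `Prop33i_directSumOfNumberFields''` -/

section HeaderBinders

variable {A : Type v} [Fintype A] (F : A → Type u) [∀ α, Field (F α)] [∀ α, NumberField (F α)]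
  [∀ α, Algebra ℚ (F α)]

/-- **IUTchIII:Prop3.3(i)** (p. 100) DISCHARGED for the statement whose hypotheses sit in the def
header (`Prop33i_directSumOfNumberFields''`, GlobalPacketsLGP.lean v3, after finding G-BINDER-DROP):
for number fields `(†𝕄⊛_mod)_α`, the global tensor packet is ring-isomorphic to a finite product of
number fields. The binders of this theorem are exactly the parameters of the named statement.
[claim: Mochizuki2012, status: disputed] -/
theorem Prop33i_directSumOfNumberFields''_holds : Prop33i_directSumOfNumberFields'' F :=
  Prop33i_directSumOfNumberFields_of_numberField F

end HeaderBinders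

end Literature.IUT.LogThetaLattice
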